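import Summits.CriticalPhenomena.Ising3DConformalLimit.Theorems.UnitSpeedTwoPoint.Negative.FalseWithoutLimit
import Summits.CriticalPhenomena.Ising3DConformalLimit.Theorems.UnitSpeedTwoPoint.Negative.MeasureNotFinite
import Summits.CriticalPhenomena.Ising3DConformalLimit.Theorems.UnitSpeedTwoPoint.Negative.StubLaplaceMeasurePowerLawSharp
import Summits.CriticalPhenomena.Ising3DConformalLimit.Theorems.HyperoctahedralRPTwoPointLimitIsotropicHolds

/-!
# Disproof of `UnitSpeedTwoPoint` — findings (crux stmt-CriticalPhenomena-17167, route UnitLightCone)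

Standing disprover file (refuter-cdisprove-stmt-CriticalPhenomena-17167-0, cycle 1, 2026-08-17; v2 after landing).
Everything below is `sorry`-free and kernel-checked except the final `NearMisses` section.  The conclusive
content is LANDED under `Theorems/UnitSpeedTwoPoint/Negative/` (imported above) and only indexed / aliased here:

| landed module (proposal) | main declarations |
|---|---|
| `Negative/FalseWithoutLimit.lean` (p161531) | `pointwise_lightCone`, `lightCone_secondDifference`, `no_unitCone_measure_for_Ksq`, `unitSpeedTwoPoint_false_without_hlim` |
| `Negative/MeasureNotFinite.lean` (p161587) | `no_finite_unitCone_measure_of_powerLaw`, `unitSpeedTwoPoint_measure_not_finite` |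
| `Negative/StubLaplaceMeasurePowerLawSharp.lean` (p161629) | `laplaceMeasurePowerLaw_false_below_half`, `stub_laplaceMeasurePowerLaw_false_without_half` |
| `Negative/ConeNotNarrowableToSpeedTwo.lean` (p161846; inlined below, not imported) | `pointwise_cone`, `cone_secondDifference`, `rpow_neg_two_mul_le_endpoints`, `unitSpeedTwoPoint_cone_not_narrowable_to_speed_two` |

**Verdict of cycle 1: NO KILL, and none is expected.**  With the Ising input `hlim` the crux is PROVABLE NOW: the
landed tree theorems `HyperoctahedralRPTwoPoint.kernel_rotation_invariant` + `twoPointKernelOfLimit_proof` make the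
limit kernel `K = C₀‖x‖^{-2Δ}`, `C₀ > 0`, `1/2 ≤ Δ ≤ 1`, and the conclusion is then the classical unit-cone
Källén–Lehmann representation of the conformal power kernel (lines `Lines/birth.lean`, `Lines/yukawa_subordination.lean`;
refuter evidence `Reduction.lean` of 2026-08-17T06:09Z).  All three stubs of the PICKED line `yukawa_subordination`
were re-derived on paper and are TRUE as typed (A: `ν = δ₀` / Gamma density, every `Δ ≥ 1/2`; B: constant `2π`
= `p₃`-integral `e^{-Ω|t|}/(2Ω)` of the `3`-D Fourier representation of `e^{-mr}/(4πr)`, `m = 0` = Weyl;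
C: Fubini over an s-finite `ν`, integrability fed at `a = b = 0`).  What the disprover established:

* `lightCone_secondDifference` / `cone_secondDifference` — REAL-VARIABLE consequences of a cone-carried KL
  representation (model-blind, reusable): `2K(0,t) ≤ K((v h) e₀,t) + (K(0,t+h) + K(0,t-h))/2` for `0 ≤ h < t` when
  `μ{ω < v‖k‖} = 0` ("a transverse step of length `v h` costs no more than a time step `h`").  This is the cheapest
  falsifier of any CANDIDATE spectral measure / kernel / cone constant.
* LOAD-BEARING ANALYSIS — `unitSpeedTwoPoint_false_without_hlim : ¬ UnitSpeedTwoPointWithoutLimit`: with `hρ`/`hlim`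
  deleted the crux is FALSE.  Witness: the squashed free field `Ssq`, kernel `Ksq = (x₀² + x₁² + x₂²/4)^{-1/2}`
  (speed of light `1/2` along `e₂`), normalised, non-degenerate, translation invariant, scale covariant with
  `Δ = 1/2`; its `e₂`-frame clause fails the second-difference inequality at `t = 1`, `h = 3/10`
  (`4 ≤ 10/√34 + 200/91 ≈ 3.913` is false).  So every proof must use the Ising input, and what it must extract from
  it is ISOTROPY at the two-point level (the diagonal-frame clause of `Ssq` holds — that frame sees speeds `1` and
  `2`): the crux is "roundness in disguise", in line with the route review (ULC-review.md §2).  The other hypotheses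
  are not independently load-bearing: `hnorm` is unused by both lines (mutation: unnecessary), `hnd`/`htr`/`hsc`
  enter only through `twoPointKernelOfLimit_proof`.
* NATURAL STRENGTHENING REFUTED — `unitSpeedTwoPoint_measure_not_finite`: no finite (let alone probability)
  measure realises the `e₂`-frame clause for any admissible limit (`∫ e^{-ωt} dμ ≤ μ(univ)` versus `C t^{-2Δ} → ∞`);
  the KL measure is infinite but s-finite — no `IsFiniteMeasure` API, stub C's `SFinite ν` is the right generality.
* TIGHTNESS — `unitSpeedTwoPoint_cone_not_narrowable_to_speed_two`: for every admissible limit the support clause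
  cannot be sharpened to `μ{ω < 2‖k‖} = 0` (speed-`2` second difference at `t = 1`, `h = 1/5`; the bound
  `(29/25)^{-Δ} + ((6/5)^{-2Δ} + (4/5)^{-2Δ})/2` is convex in `Δ` and `< 2` at `Δ = 1/2, 1`).  The constant `1` is
  within a factor `2` of optimal (truth: every `v > 1` fails — NearMisses).
* LINE `yukawa_subordination`, stub A — `laplaceMeasurePowerLaw_false_below_half`: the guard `1/2 ≤ Δ` is SHARP
  (for `Δ < 1/2`, `r^{1-2Δ}` is increasing, not a Laplace transform of a positive measure); the only Δ-sensitive
  input of the line, fed by the tree's infrared-bound window — nothing in the line is soft.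
* `NearMisses` (documented, not closed): (i) for speeds `1/√(2Δ+1) ≤ c < 1` the squashed kernel still has no
  unit-cone measure but the second-difference test is blind there (full range needs Fourier–Laplace uniqueness /
  Paley–Wiener — the content of the sibling crux `TwoPointLightConeRigidity`); (ii) at the endpoint `Δ = 1/2` the
  KL measure is the SINGULAR cone measure `(2π‖k‖)⁻¹ d²k δ(ω-‖k‖)`, so "μ ≪ Lebesgue" and the open-cone support
  `μ{ω ≤ ‖k‖} = 0` are false at `Δ = 1/2` — provers of stub A / birth's `stub_unitConeKLPowerLaw` must case-split
  `Δ = 1/2` (ν = δ₀) versus `Δ > 1/2`; (iii) every cone speed `v > 1` (not only `v ≥ 2`) fails for the round kernel.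

Targets (lead's stuck stubs): none armed in cycle 1 (`payload.targets = []`).
-/

noncomputable section

namespace Summit.CriticalPhenomena.Ising3DConformalLimit.Cruxes.UnitSpeedTwoPoint.Disproof

open MeasureTheory
open Literature.Probability.LatticeModels
open Summit.CriticalPhenomena.Ising3DConformalLimit.Theorems.UnitSpeedTwoPoint.Negative

/-! ## Load-bearing analysis: the crux without the Ising input `hlim` -/

/-- **`UnitSpeedTwoPoint` with the Ising input removed** — hypotheses `hρ`/`hlim` (`HasPointwiseScalingLimit
(criticalCorr 3) ρ S`) dropped, everything else (normalisation, non-degeneracy, translation invariance, scale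
covariance, and the two-frame unit-cone conclusion) verbatim. -/
def UnitSpeedTwoPointWithoutLimit : Prop :=
  ∀ (Δ : ℝ) (S : Literature.Probability.LatticeModels.CorrFamily 3), (∀ n z, z ∉ Literature.Probability.LatticeModels.NonCoincident 3 n → S n z = 0) → Literature.Probability.LatticeModels.IsNondegenerateTwoPoint S → Literature.Probability.LatticeModels.IsTranslationInvariant S → Literature.Probability.LatticeModels.IsScaleCovariant Δ S → (∃ μ : MeasureTheory.Measure (EuclideanSpace ℝ (Fin 2) × ℝ), μ {p : EuclideanSpace ℝ (Fin 2) × ℝ | p.2 < ‖p.1‖} = 0 ∧ (∀ t a b : ℝ, t ≠ 0 → (fun x : EuclideanSpace ℝ (Fin 3) => S 2 ![0, x]) (EuclideanSpace.single 0 a + EuclideanSpace.single 1 b + EuclideanSpace.single 2 t) = ∫ p, Real.cos (p.1 0 * a + p.1 1 * b) * Real.exp (-(p.2 * |t|)) ∂μ)) ∧ (∃ μ : MeasureTheory.Measure (EuclideanSpace ℝ (Fin 2) × ℝ), μ {p : EuclideanSpace ℝ (Fin 2) × ℝ | p.2 < ‖p.1‖} = 0 ∧ (∀ t u v : ℝ,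 t ≠ 0 → (fun x : EuclideanSpace ℝ (Fin 3) => S 2 ![0, x]) (EuclideanSpace.single 0 ((t + u) / Real.sqrt 2) + EuclideanSpace.single 1 ((t - u) / Real.sqrt 2) + EuclideanSpace.single 2 v) = ∫ p, Real.cos (p.1 0 * u + p.1 1 * v) * Real.exp (-(p.2 * |t|)) ∂μ))

/-- **Any proof of `UnitSpeedTwoPoint` must use the Ising input `hlim`** (landed as
`Negative.unitSpeedTwoPoint_false_without_hlim`, p161531). [cite: GlimmJaffe1987, §6.2] -/
theorem unitSpeedTwoPoint_false_without_hlim : ¬ UnitSpeedTwoPointWithoutLimit :=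
  Summit.CriticalPhenomena.Ising3DConformalLimit.Theorems.UnitSpeedTwoPoint.Negative.unitSpeedTwoPoint_false_without_hlim

/-! ## The named witness (the landed proof builds it locally): squashed free field, speed of light `1/2` along `e₂`

Kept here as a NAMED test object for ideators / triagers: any candidate mechanism that does not use isotropy must
fail on `Ssq`. -/

/-- The squashed kernel `K(x) = (x₀² + x₁² + x₂²/4)^{-1/2}`: the massless free two-point function of `ℝ³` read in
coordinates where signals along `e₂` travel at speed `1/2`; positive, `(-1)`-homogeneous, smooth off `0`,
translation/scale covariant with `Δ = 1/2`, but its `e₂`-frame Källén–Lehmann measure lives on `ω = ‖k‖/2 < ‖k‖`. [folklore] -/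
def Ksq (x : EuclideanSpace ℝ (Fin 3)) : ℝ := (Real.sqrt (x 0 ^ 2 + x 1 ^ 2 + x 2 ^ 2 / 4))⁻¹

/-- The witness family: `S 2 (x, y) = Ksq (y - x)` off the diagonal, everything else `0`. [folklore] -/
def Ssq : CorrFamily 3 := fun n z =>
  if h : n = 2 then (if z ⟨0, by omega⟩ = z ⟨1, by omega⟩ then 0 else Ksq (z ⟨1, by omega⟩ - z ⟨0, by omega⟩))
  else 0

/-- The two-point entry of the witness family. [folklore] -/
theorem Ssq_two (z : Fin 2 → EuclideanSpace ℝ (Fin 3)) :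
    Ssq 2 z = if z 0 = z 1 then 0 else Ksq (z 1 - z 0) := by
  simp [Ssq]

/-- All `n ≠ 2` entries of the witness family vanish. [folklore] -/
theorem Ssq_of_ne_two {n : ℕ} (hn : n ≠ 2) (z : Fin n → EuclideanSpace ℝ (Fin 3)) : Ssq n z = 0 := by
  simp [Ssq, hn]

/-- `Ksq` is homogeneous of degree `-1`. [folklore] -/
theorem Ksq_smul {c : ℝ} (hc : 0 < c) (x : EuclideanSpace ℝ (Fin 3)) : Ksq (c • x) = c⁻¹ * Ksq x := by
  simp only [Ksq, PiLp.smul_apply, smul_eq_mul]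
  have hq : 0 ≤ x 0 ^ 2 + x 1 ^ 2 + x 2 ^ 2 / 4 := by positivity
  have : (c * x 0) ^ 2 + (c * x 1) ^ 2 + (c * x 2) ^ 2 / 4 = c ^ 2 * (x 0 ^ 2 + x 1 ^ 2 + x 2 ^ 2 / 4) := by ring
  rw [this, Real.sqrt_mul (sq_nonneg c), Real.sqrt_sq hc.le, mul_inv]

/-- `Ksq` is positive off the origin. [folklore] -/
theorem Ksq_pos {x : EuclideanSpace ℝ (Fin 3)} (hx : x ≠ 0) : 0 < Ksq x := by
  unfold Ksq
  apply inv_pos.2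
  apply Real.sqrt_pos.2
  by_contra hle
  push Not at hle
  have h0 : x 0 = 0 := by nlinarith [sq_nonneg (x 0), sq_nonneg (x 1), sq_nonneg (x 2)]
  have h1 : x 1 = 0 := by nlinarith [sq_nonneg (x 0), sq_nonneg (x 1), sq_nonneg (x 2)]
  have h2 : x 2 = 0 := by nlinarith [sq_nonneg (x 0), sq_nonneg (x 1), sq_nonneg (x 2)]
  apply hx
  ext i
  fin_cases i <;> simp [h0, h1, h2]

/-- The witness family is normalised: `0` off the non-coincident configurations. [folklore] -/
theorem Ssq_norm : ∀ n z, z ∉ NonCoincident 3 n → Ssq n z = 0 := by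
  intro n z hz
  by_cases hn : n = 2
  · subst hn
    rw [mem_nonCoincident, Literature.Barriers.CriticalPhenomena.ScaleNotMoebius.injective_fin_two_iff,
      not_not] at hz
    rw [Ssq_two, if_pos hz]
  · exact Ssq_of_ne_two hn z

/-- The witness family has a non-degenerate (positive) two-point function. [folklore] -/
theorem Ssq_nondegenerate : IsNondegenerateTwoPoint Ssq := by
  intro z hz
  rw [mem_nonCoincident, Literature.Barriers.CriticalPhenomena.ScaleNotMoebius.injective_fin_two_iff] at hz
  rw [Ssq_two, if_neg hz]
  exact Ksq_pos (sub_ne_zero.2 (Ne.symm hz))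

/-- The witness family is translation invariant. [folklore] -/
theorem Ssq_translationInvariant : IsTranslationInvariant Ssq := by
  intro n v z
  by_cases hn : n = 2
  · subst hn
    simp only [Ssq_two, add_left_inj, add_sub_add_right_eq_sub]
  · simp [Ssq_of_ne_two hn]

/-- The witness family is scale covariant with `Δ = 1/2`. [folklore] -/
theorem Ssq_scaleCovariant : IsScaleCovariant (1 / 2) Ssq := by
  intro n c hc z
  by_cases hn : n = 2
  · subst hn
    have hexp : c ^ (-((2 : ℕ) : ℝ) * (1 / 2)) = c⁻¹ := by
      rw [show (-((2 : ℕ) : ℝ) * (1 / 2)) = -1 by norm_num, Real.rpow_neg_one]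
    simp only [Ssq_two, hexp]
    by_cases hz : z 0 = z 1
    · simp [hz]
    · have hcz : c • z 0 ≠ c • z 1 := fun h => hz (smul_right_injective _ hc.ne' h)
      rw [if_neg hcz, if_neg hz, ← smul_sub, Ksq_smul hc]
  · simp [Ssq_of_ne_two hn]

/-- The witness kernel at the axis-frame point `a e₀ + b e₁ + t e₂`, `t ≠ 0`. [folklore] -/
theorem Ssq_axis (a b t : ℝ) (ht : t ≠ 0) :
    Ssq 2 ![0, EuclideanSpace.single 0 a + EuclideanSpace.single 1 b + EuclideanSpace.single 2 t] =
      (Real.sqrt (a ^ 2 + b ^ 2 + t ^ 2 / 4))⁻¹ := by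
  set p : EuclideanSpace ℝ (Fin 3) :=
    EuclideanSpace.single 0 a + EuclideanSpace.single 1 b + EuclideanSpace.single 2 t with hp
  have h0 : p 0 = a := by simp [hp]
  have h1 : p 1 = b := by simp [hp]
  have h2 : p 2 = t := by simp [hp]
  have hp0 : p ≠ 0 := by
    intro h
    rw [h] at h2
    exact ht (by simpa using h2.symm)
  rw [Ssq_two]
  simp only [Matrix.cons_val_zero, Matrix.cons_val_one]
  rw [if_neg (Ne.symm hp0), sub_zero, Ksq, h0, h1, h2]

/-- The `e₂`-frame clause of the crux fails for the witness `Ssq` (via the landed `no_unitCone_measure_for_Ksq`).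
[folklore] -/
theorem Ssq_axisClause_false :
    ¬ ∃ μ : Measure (EuclideanSpace ℝ (Fin 2) × ℝ), μ {p : EuclideanSpace ℝ (Fin 2) × ℝ | p.2 < ‖p.1‖} = 0 ∧
      ∀ t a b : ℝ, t ≠ 0 →
        Ssq 2 ![0, EuclideanSpace.single 0 a + EuclideanSpace.single 1 b + EuclideanSpace.single 2 t] =
          ∫ p, Real.cos (p.1 0 * a + p.1 1 * b) * Real.exp (-(p.2 * |t|)) ∂μ := by
  rintro ⟨μ, hμ, hrep⟩
  exact no_unitCone_measure_for_Ksq μ hμ fun t a b ht => by rw [← Ssq_axis a b t ht]; exact hrep t a b ht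

/-! ## Strengthenings refuted and tightness (aliases of the landed theorems, for the record) -/

/-- No finite measure realises the `e₂`-frame clause of the crux for any admissible limit (p161587).
[cite: GlimmJaffe1987, §6.2] -/
theorem measure_not_finite {ρ : ℝ → ℝ} {Δ : ℝ} {S : CorrFamily 3}
    (hρ : ∀ δ ∈ Set.Ioc (0:ℝ) 1, 0 < ρ δ) (hlim : HasPointwiseScalingLimit (criticalCorr 3) ρ S)
    (hnd : IsNondegenerateTwoPoint S) (htr : IsTranslationInvariant S) (hsc : IsScaleCovariant Δ S)
    (μ : Measure (EuclideanSpace ℝ (Fin 2) × ℝ)) (hμ : μ {p : EuclideanSpace ℝ (Fin 2) × ℝ | p.2 < ‖p.1‖} = 0)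
    (hrep : ∀ t a b : ℝ, t ≠ 0 → (fun x : EuclideanSpace ℝ (Fin 3) => S 2 ![0, x])
      (EuclideanSpace.single 0 a + EuclideanSpace.single 1 b + EuclideanSpace.single 2 t) =
        ∫ p, Real.cos (p.1 0 * a + p.1 1 * b) * Real.exp (-(p.2 * |t|)) ∂μ) :
    ¬ IsFiniteMeasure μ :=
  unitSpeedTwoPoint_measure_not_finite hρ hlim hnd htr hsc μ hμ hrep

/-! ### Tightness: the speed-2 cone fails (content of the landed `Negative/ConeNotNarrowableToSpeedTwo.lean`, p161846,
inlined here verbatim because the farm had not yet built that module when this version was published) -/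

/-- Pointwise speed-`v` light-cone inequality: if `|v k₀| ≤ ω` then
`2 e^{-ωt} ≤ cos(k₀ (v h)) e^{-ωt} + (e^{-ω(t+h)} + e^{-ω(t-h)})/2` (`cos θ ≥ 1 - θ²/2`, `cosh θ ≥ 1 + θ²/2`).
[folklore] -/
theorem pointwise_cone {v k0 ω t : ℝ} (h : ℝ) (hk : |v * k0| ≤ ω) :
    2 * Real.exp (-(ω * t)) ≤ Real.cos (k0 * (v * h)) * Real.exp (-(ω * t)) +
      (Real.exp (-(ω * (t + h))) + Real.exp (-(ω * (t - h)))) / 2 := by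
  have hE : 0 < Real.exp (-(ω * t)) := Real.exp_pos _
  have h1 : Real.exp (-(ω * (t + h))) = Real.exp (-(ω * t)) * Real.exp (-(ω * h)) := by
    rw [← Real.exp_add]; congr 1; ring
  have h2 : Real.exp (-(ω * (t - h))) = Real.exp (-(ω * t)) * Real.exp (ω * h) := by
    rw [← Real.exp_add]; congr 1; ring
  have harg : k0 * (v * h) = (v * k0) * h := by ring
  have hcos : 1 - ((v * k0) * h) ^ 2 / 2 ≤ Real.cos (k0 * (v * h)) := by
    rw [harg]; exact Real.one_sub_sq_div_two_le_cos
  have hcosh : 1 + (ω * h) ^ 2 / 2 ≤ Real.cosh (ω * h) := by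
    -- first two terms of the power series (cf. `DeBruijn1950.one_add_sq_div_two_le_cosh`)
    have hs := sum_le_hasSum (Finset.range 2)
      (fun n _ ↦ div_nonneg (by rw [pow_mul]; positivity) (Nat.cast_nonneg _)) (Real.hasSum_cosh (ω * h))
    simpa [Finset.sum_range_succ, Nat.factorial] using hs
  have hcosh' : Real.cosh (ω * h) = (Real.exp (ω * h) + Real.exp (-(ω * h))) / 2 := Real.cosh_eq _
  have hsq : ((v * k0) * h) ^ 2 ≤ (ω * h) ^ 2 := by
    rw [mul_pow, mul_pow ω]
    apply mul_le_mul_of_nonneg_right _ (sq_nonneg _)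
    exact sq_le_sq' (by linarith [neg_abs_le (v * k0)]) (le_trans (le_abs_self _) hk)
  have hbr : 0 ≤ Real.cos (k0 * (v * h)) + (Real.exp (-(ω * h)) + Real.exp (ω * h)) / 2 - 2 := by
    have : (Real.exp (-(ω * h)) + Real.exp (ω * h)) / 2 = Real.cosh (ω * h) := by rw [hcosh']; ring
    rw [this]; linarith
  rw [h1, h2]
  nlinarith [mul_nonneg hE.le hbr]

/-- **Speed-`v` second-difference inequality.** If a positive measure `μ` on `ℝ² × ℝ` is carried by the cone
`{ω ≥ v‖k‖}` (`v ≥ 0`) and `e^{-ω(t-h)}` is integrable (`0 ≤ h < t`), then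
`2 ∫ e^{-ω|t|} dμ ≤ ∫ cos(k₀ (v h)) e^{-ω|t|} dμ + (∫ e^{-ω|t+h|} dμ + ∫ e^{-ω|t-h|} dμ)/2`: for a kernel with such a
representation a transverse step of length `v h` costs at most a time step of length `h`. [folklore] -/
theorem cone_secondDifference {v : ℝ} (hv : 0 ≤ v) (μ : Measure (EuclideanSpace ℝ (Fin 2) × ℝ))
    (hμ : μ {p : EuclideanSpace ℝ (Fin 2) × ℝ | p.2 < v * ‖p.1‖} = 0) {t h : ℝ} (hh : 0 ≤ h) (hht : h < t)
    (hint : Integrable (fun p : EuclideanSpace ℝ (Fin 2) × ℝ => Real.exp (-(p.2 * |t - h|))) μ) :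
    2 * ∫ p, Real.exp (-(p.2 * |t|)) ∂μ ≤
      (∫ p, Real.cos (p.1 0 * (v * h)) * Real.exp (-(p.2 * |t|)) ∂μ) +
        ((∫ p, Real.exp (-(p.2 * |t + h|)) ∂μ) + (∫ p, Real.exp (-(p.2 * |t - h|)) ∂μ)) / 2 := by
  have hae : ∀ᵐ p ∂μ, v * ‖p.1‖ ≤ p.2 := by
    have h0 := measure_eq_zero_iff_ae_notMem.1 hμ
    filter_upwards [h0] with p hp
    simpa [Set.mem_setOf_eq, not_lt] using hp
  have ht : 0 < t := lt_of_le_of_lt hh hht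
  have habs_t : |t| = t := abs_of_pos ht
  have habs_p : |t + h| = t + h := abs_of_pos (by linarith)
  have habs_m : |t - h| = t - h := abs_of_pos (by linarith)
  have hω : ∀ p : EuclideanSpace ℝ (Fin 2) × ℝ, v * ‖p.1‖ ≤ p.2 → 0 ≤ p.2 := fun p hp =>
    le_trans (mul_nonneg hv (norm_nonneg _)) hp
  have hdom : ∀ p : EuclideanSpace ℝ (Fin 2) × ℝ, v * ‖p.1‖ ≤ p.2 → ∀ s : ℝ, t - h ≤ s →
      Real.exp (-(p.2 * s)) ≤ Real.exp (-(p.2 * (t - h))) := by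
    intro p hp s hs
    have := hω p hp
    exact Real.exp_le_exp.2 (by nlinarith)
  have hint_t : Integrable (fun p : EuclideanSpace ℝ (Fin 2) × ℝ => Real.exp (-(p.2 * |t|))) μ := by
    refine hint.mono' (by fun_prop) ?_
    filter_upwards [hae] with p hp
    rw [Real.norm_eq_abs, abs_of_pos (Real.exp_pos _), habs_t, habs_m]
    exact hdom p hp t (by linarith)
  have hint_p : Integrable (fun p : EuclideanSpace ℝ (Fin 2) × ℝ => Real.exp (-(p.2 * |t + h|))) μ := by
    refine hint.mono' (by fun_prop) ?_
    filter_upwards [hae] with p hp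
    rw [Real.norm_eq_abs, abs_of_pos (Real.exp_pos _), habs_p, habs_m]
    exact hdom p hp (t + h) (by linarith)
  have hint_c : Integrable (fun p : EuclideanSpace ℝ (Fin 2) × ℝ =>
      Real.cos (p.1 0 * (v * h)) * Real.exp (-(p.2 * |t|))) μ := by
    refine hint_t.mono' (by fun_prop) ?_
    filter_upwards with p
    rw [norm_mul, Real.norm_eq_abs, Real.norm_eq_abs, abs_of_pos (Real.exp_pos _)]
    exact mul_le_of_le_one_left (Real.exp_pos _).le (Real.abs_cos_le_one _)
  have key : 0 ≤ ∫ p, ((Real.cos (p.1 0 * (v * h)) * Real.exp (-(p.2 * |t|)) +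
      (Real.exp (-(p.2 * |t + h|)) + Real.exp (-(p.2 * |t - h|))) / 2) -
      2 * Real.exp (-(p.2 * |t|))) ∂μ := by
    apply integral_nonneg_of_ae
    filter_upwards [hae] with p hp
    rw [Pi.zero_apply, sub_nonneg, habs_t, habs_p, habs_m]
    refine pointwise_cone h (le_trans ?_ hp)
    rw [abs_mul, abs_of_nonneg hv]
    exact mul_le_mul_of_nonneg_left (by simpa using PiLp.norm_apply_le p.1 0) hv
  have hI3 : Integrable (fun p : EuclideanSpace ℝ (Fin 2) × ℝ =>
      (Real.exp (-(p.2 * |t + h|)) + Real.exp (-(p.2 * |t - h|))) / 2) μ := (hint_p.add hint).div_const 2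
  have hI1 : Integrable (fun p : EuclideanSpace ℝ (Fin 2) × ℝ =>
      Real.cos (p.1 0 * (v * h)) * Real.exp (-(p.2 * |t|)) +
        (Real.exp (-(p.2 * |t + h|)) + Real.exp (-(p.2 * |t - h|))) / 2) μ := hint_c.add hI3
  have hI2 : Integrable (fun p : EuclideanSpace ℝ (Fin 2) × ℝ => 2 * Real.exp (-(p.2 * |t|))) μ :=
    hint_t.const_mul 2
  rw [integral_sub hI1 hI2, integral_add hint_c hI3, integral_div, integral_add hint_p hint,
    integral_const_mul] at key
  linarith

/-- Convexity in the exponent between `Δ = 1/2` and `Δ = 1`: for `B > 0` and `1/2 ≤ Δ ≤ 1`,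
`B^{-2Δ} ≤ θ B⁻¹ + (1 - θ) B⁻²` with `θ = 2(1 - Δ)`. [folklore] -/
theorem rpow_neg_two_mul_le_endpoints {B Δ : ℝ} (hB : 0 < B) (h1 : 1 / 2 ≤ Δ) (h2 : Δ ≤ 1) :
    B ^ (-(2 * Δ)) ≤ (2 * (1 - Δ)) * B⁻¹ + (1 - 2 * (1 - Δ)) * (B ^ 2)⁻¹ := by
  have hθ0 : 0 ≤ 2 * (1 - Δ) := by linarith
  have hθ1 : 0 ≤ 1 - 2 * (1 - Δ) := by linarith
  have key := convexOn_exp.2 (Set.mem_univ (Real.log B * (-1))) (Set.mem_univ (Real.log B * (-2))) hθ0 hθ1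
    (by ring)
  simp only [smul_eq_mul] at key
  have hexp : 2 * (1 - Δ) * (Real.log B * -1) + (1 - 2 * (1 - Δ)) * (Real.log B * -2) =
      Real.log B * (-(2 * Δ)) := by ring
  rw [hexp, ← Real.rpow_def_of_pos hB, ← Real.rpow_def_of_pos hB, ← Real.rpow_def_of_pos hB,
    Real.rpow_neg_one, Real.rpow_neg hB.le (2:ℝ), Real.rpow_two] at key
  exact key

/-- **TIGHTNESS of the support clause of `UnitSpeedTwoPoint`: the unit cone cannot be narrowed to the speed-`2`
cone.**  For every admissible limit `(ρ, Δ, S)` of the crux there is NO measure `μ` on `ℝ² × ℝ` with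
`μ{ω < 2‖k‖} = 0` realising the axis-frame clause: the kernel is `C₀‖x‖^{-2Δ}` (`kernel_rotation_invariant`,
`twoPointKernelOfLimit_proof`), and the speed-`2` second-difference inequality at `t = 1`, `h = 1/5`,
`2 ≤ (29/25)^{-Δ} + ((6/5)^{-2Δ} + (4/5)^{-2Δ})/2`, fails on the whole window `1/2 ≤ Δ ≤ 1` (convexity in `Δ` plus
the endpoint values `≈ 1.970`, `≈ 1.991`). [cite: GlimmJaffe1987, §6.2] -/
theorem unitSpeedTwoPoint_cone_not_narrowable_to_speed_two {ρ : ℝ → ℝ} {Δ : ℝ} {S : CorrFamily 3}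
    (hρ : ∀ δ ∈ Set.Ioc (0:ℝ) 1, 0 < ρ δ) (hlim : HasPointwiseScalingLimit (criticalCorr 3) ρ S)
    (hnd : IsNondegenerateTwoPoint S) (htr : IsTranslationInvariant S) (hsc : IsScaleCovariant Δ S) :
    ¬ ∃ μ : Measure (EuclideanSpace ℝ (Fin 2) × ℝ),
      μ {p : EuclideanSpace ℝ (Fin 2) × ℝ | p.2 < 2 * ‖p.1‖} = 0 ∧
        ∀ t a b : ℝ, t ≠ 0 → (fun x : EuclideanSpace ℝ (Fin 3) => S 2 ![0, x])
          (EuclideanSpace.single 0 a + EuclideanSpace.single 1 b + EuclideanSpace.single 2 t) =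
            ∫ p, Real.cos (p.1 0 * a + p.1 1 * b) * Real.exp (-(p.2 * |t|)) ∂μ := by
  rintro ⟨μ, hμ, hrep⟩
  -- tree input: window, positivity, homogeneity (item 1983) and O(3)-invariance (milestone 1984)
  obtain ⟨⟨hΔ1, hΔ2⟩, _, hpos, hhom, _⟩ :=
    Summit.CriticalPhenomena.Ising3DConformalLimit.HyperoctahedralRPTwoPoint.twoPointKernelOfLimit_proof
      ρ Δ S hρ hlim hnd htr hsc
  have hrot : ∀ (R : EuclideanSpace ℝ (Fin 3) ≃ₗᵢ[ℝ] EuclideanSpace ℝ (Fin 3)) (x : EuclideanSpace ℝ (Fin 3)),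
      S 2 ![0, R x] = S 2 ![0, x] := fun R x =>
    Summit.CriticalPhenomena.Ising3DConformalLimit.HyperoctahedralRPTwoPoint.kernel_rotation_invariant
      hρ hlim hnd htr hsc R x
  -- radial profile (Cartan–Dieudonné, as in `Lines/yukawa_subordination.lean`): K x = C₀ ‖x‖^{-2Δ} off 0
  set e : EuclideanSpace ℝ (Fin 3) := EuclideanSpace.single 2 (1 : ℝ) with he_def
  have he1 : ‖e‖ = 1 := by simp [he_def]
  set C₀ : ℝ := S 2 ![0, e] with hC₀
  have hK : ∀ x : EuclideanSpace ℝ (Fin 3), x ≠ 0 → S 2 ![0, x] = C₀ * ‖x‖ ^ (-(2 * Δ)) := by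
    intro x hx
    have hn : 0 < ‖x‖ := norm_pos_iff.mpr hx
    set u : EuclideanSpace ℝ (Fin 3) := ‖x‖⁻¹ • x with hu
    have hu1 : ‖u‖ = 1 := by rw [hu, norm_smul, norm_inv, norm_norm, inv_mul_cancel₀ hn.ne']
    have hxu : x = ‖x‖ • u := by rw [hu, smul_smul, mul_inv_cancel₀ hn.ne', one_smul]
    have hKu : S 2 ![0, u] = C₀ := by
      have h := Submodule.reflection_sub (show ‖e‖ = ‖u‖ by rw [hu1, he1])
      have h2 := hrot ((ℝ ∙ (e - u))ᗮ.reflection) e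
      rw [h] at h2
      exact h2
    calc S 2 ![0, x] = S 2 ![0, ‖x‖ • u] := by rw [← hxu]
      _ = ‖x‖ ^ (-(2 * Δ)) * S 2 ![0, u] := hhom _ hn u
      _ = C₀ * ‖x‖ ^ (-(2 * Δ)) := by rw [hKu, mul_comm]
  have hC₀pos : 0 < C₀ := by
    have he0 : e ≠ 0 := fun h => by
      rw [h, norm_zero] at he1
      exact zero_ne_one he1
    exact hpos e he0
  -- axis-frame values
  have hnorm : ∀ a b t : ℝ, ‖(EuclideanSpace.single 0 a + EuclideanSpace.single 1 b + EuclideanSpace.single 2 t :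
      EuclideanSpace ℝ (Fin 3))‖ = Real.sqrt (a ^ 2 + b ^ 2 + t ^ 2) := by
    intro a b t
    set p : EuclideanSpace ℝ (Fin 3) :=
      EuclideanSpace.single 0 a + EuclideanSpace.single 1 b + EuclideanSpace.single 2 t with hp
    have h0 : p 0 = a := by simp [hp]
    have h1 : p 1 = b := by simp [hp]
    have h2 : p 2 = t := by simp [hp]
    rw [EuclideanSpace.norm_eq, Fin.sum_univ_three]
    simp only [Real.norm_eq_abs, sq_abs, h0, h1, h2]
  have hne : ∀ a b t : ℝ, t ≠ 0 → (EuclideanSpace.single 0 a + EuclideanSpace.single 1 b +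
      EuclideanSpace.single 2 t : EuclideanSpace ℝ (Fin 3)) ≠ 0 := by
    intro a b t ht h
    have h2 : (EuclideanSpace.single 0 a + EuclideanSpace.single 1 b + EuclideanSpace.single 2 t :
        EuclideanSpace ℝ (Fin 3)) 2 = t := by simp
    rw [h] at h2
    exact ht (by simpa using h2.symm)
  have hval : ∀ a b t : ℝ, t ≠ 0 →
      C₀ * Real.sqrt (a ^ 2 + b ^ 2 + t ^ 2) ^ (-(2 * Δ)) =
        ∫ p, Real.cos (p.1 0 * a + p.1 1 * b) * Real.exp (-(p.2 * |t|)) ∂μ := by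
    intro a b t ht
    have h := hrep t a b ht
    simp only [] at h
    rw [hK _ (hne a b t ht), hnorm] at h
    exact h
  -- the four values entering the speed-2 second difference at t = 1, h = 1/5 (transverse step 2h = 2/5)
  have H1 := hval (2 * (1 / 5)) 0 1 one_ne_zero
  have H2 := hval 0 0 1 one_ne_zero
  have H3 := hval 0 0 (1 + 1 / 5) (by norm_num)
  have H4 := hval 0 0 (1 - 1 / 5) (by norm_num)
  simp only [mul_zero, add_zero, Real.cos_zero, one_mul] at H2 H3 H4
  simp only [mul_zero, add_zero] at H1
  have hs1 : Real.sqrt (0 ^ 2 + 0 ^ 2 + (1:ℝ) ^ 2) = 1 := by norm_num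
  have hs3 : Real.sqrt (0 ^ 2 + 0 ^ 2 + (1 + 1 / 5 : ℝ) ^ 2) = 6 / 5 := by
    rw [show (0:ℝ) ^ 2 + 0 ^ 2 + (1 + 1 / 5) ^ 2 = (6 / 5) ^ 2 by norm_num]
    exact Real.sqrt_sq (by norm_num)
  have hs4 : Real.sqrt (0 ^ 2 + 0 ^ 2 + (1 - 1 / 5 : ℝ) ^ 2) = 4 / 5 := by
    rw [show (0:ℝ) ^ 2 + 0 ^ 2 + (1 - 1 / 5) ^ 2 = (4 / 5) ^ 2 by norm_num]
    exact Real.sqrt_sq (by norm_num)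
  rw [hs1, Real.one_rpow, mul_one] at H2
  rw [hs3] at H3
  rw [hs4] at H4
  -- integrability of e^{-ω|1 - 1/5|}
  have hint : Integrable (fun p : EuclideanSpace ℝ (Fin 2) × ℝ => Real.exp (-(p.2 * |1 - 1 / 5|))) μ := by
    by_contra hni
    rw [integral_undef hni] at H4
    have : 0 < C₀ * ((4:ℝ) / 5) ^ (-(2 * Δ)) := mul_pos hC₀pos (Real.rpow_pos_of_pos (by norm_num) _)
    linarith
  have key := cone_secondDifference (by norm_num : (0:ℝ) ≤ 2) μ hμ (by norm_num : (0:ℝ) ≤ 1 / 5)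
    (by norm_num : (1:ℝ) / 5 < 1) hint
  rw [← H1, ← H2, ← H3, ← H4] at key
  -- key : 2 * C₀ ≤ C₀ * s ^ (-2Δ) + (C₀ * (6/5) ^ (-2Δ) + C₀ * (4/5) ^ (-2Δ)) / 2,  s = √(4/25 + 0 + 1)
  set s : ℝ := Real.sqrt ((2 * (1 / 5)) ^ 2 + 0 ^ 2 + 1 ^ 2) with hs_def
  have hs_pos : 0 < s := Real.sqrt_pos.2 (by norm_num)
  have hs_sq : s ^ 2 = 29 / 25 := by rw [hs_def, Real.sq_sqrt (by norm_num)]; norm_num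
  have hs_inv : s⁻¹ < 7925 / 8352 := by
    have hlt : (8352 : ℝ) / 7925 < s := by
      rw [hs_def, Real.lt_sqrt (by norm_num)]
      norm_num
    have := inv_strictAnti₀ (by norm_num : (0:ℝ) < 8352 / 7925) hlt
    simpa using this
  -- convexity in Δ: each power is below the chord between Δ = 1/2 and Δ = 1
  have c1 := rpow_neg_two_mul_le_endpoints hs_pos hΔ1 hΔ2
  have c3 := rpow_neg_two_mul_le_endpoints (by norm_num : (0:ℝ) < 6 / 5) hΔ1 hΔ2
  have c4 := rpow_neg_two_mul_le_endpoints (by norm_num : (0:ℝ) < 4 / 5) hΔ1 hΔ2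
  rw [hs_sq] at c1
  have hθ0 : 0 ≤ 2 * (1 - Δ) := by linarith
  have hθ1 : 0 ≤ 1 - 2 * (1 - Δ) := by linarith
  -- divide the second-difference inequality by C₀ and conclude
  have key' : 2 ≤ s ^ (-(2 * Δ)) + (((6:ℝ) / 5) ^ (-(2 * Δ)) + ((4:ℝ) / 5) ^ (-(2 * Δ))) / 2 := by
    have := key
    nlinarith [hC₀pos, this]
  nlinarith [mul_nonneg hθ0 (sub_nonneg.2 hs_inv.le), key', c1, c3, c4, hθ0, hθ1]

/-- Line `yukawa_subordination`, stub A: the registered signature with the guard `1/2 ≤ Δ` deleted is false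
(p161629). [folklore] -/
theorem stubA_guard_loadBearing :
    ¬ ∀ Δ : ℝ, ∃ ν : MeasureTheory.Measure ℝ, MeasureTheory.SFinite ν ∧ ν (Set.Iio 0) = 0 ∧
        ∀ r : ℝ, 0 < r →
          MeasureTheory.Integrable (fun m : ℝ => Real.exp (-(m * r))) ν ∧
            ∫ m, Real.exp (-(m * r)) ∂ν = r ^ (1 - 2 * Δ) :=
  stub_laplaceMeasurePowerLaw_false_without_half

/-! ## NearMisses — statements believed true, NOT closed here (the only `sorry`s of this work file) -/
namespace NearMisses

/-- NEAR-MISS (i): the full speed rigidity.  For EVERY `c ∈ (0,1)` and `Δ > 0` the squashed kernel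
`(a² + b² + c²t²)^{-Δ}` has no unit-cone KL measure in the `e₂` frame (its true spectral measure sits on
`ω = c·√(‖k‖² + m²)`-shells below the cone).  Obstruction: `lightCone_secondDifference` only detects
`c² < 1/(2Δ+1)` (leading order `h²(1 - 1/(2c²Δ…))`); the full range needs uniqueness of the Fourier–Laplace
transform `(w,t) ↦ ∫ cos(k·w) e^{-ω t} dμ` (Paley–Wiener in the tube `|Im w| < Re t`), not attempted in cycle 1.
Tried: second differences (blind for `c² ≥ 1/(2Δ+1)`), fourth differences (not sharper uniformly). -/
theorem no_unitCone_measure_of_speed_lt_one {c Δ : ℝ} (hc : 0 < c) (hc1 : c < 1) (hΔ : 0 < Δ)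
    (μ : Measure (EuclideanSpace ℝ (Fin 2) × ℝ)) (hμ : μ {p : EuclideanSpace ℝ (Fin 2) × ℝ | p.2 < ‖p.1‖} = 0)
    (hrep : ∀ t a b : ℝ, t ≠ 0 → (a ^ 2 + b ^ 2 + c ^ 2 * t ^ 2) ^ (-Δ) =
      ∫ p, Real.cos (p.1 0 * a + p.1 1 * b) * Real.exp (-(p.2 * |t|)) ∂μ) : False := by
  sorry

/-- NEAR-MISS (iii): every cone speed `v > 1` fails for admissible limits (only `v = 2` is landed,
`unitSpeedTwoPoint_cone_not_narrowable_to_speed_two`).  For `1 < v < √(2Δ+1)` the speed-`v` second difference is blind (leading order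
`Δh²(v² - 2Δ - 1)`); the sharp statement needs the explicit KL measure of `‖x‖^{-2Δ}` (density
`c_Δ (ω² - ‖k‖²)^{Δ-3/2}` on the open cone for `Δ > 1/2`, the cone measure at `Δ = 1/2`) plus Laplace uniqueness in
`t`. -/
theorem cone_not_narrowable {ρ : ℝ → ℝ} {Δ : ℝ} {S : CorrFamily 3}
    (hρ : ∀ δ ∈ Set.Ioc (0:ℝ) 1, 0 < ρ δ) (hlim : HasPointwiseScalingLimit (criticalCorr 3) ρ S)
    (hnd : IsNondegenerateTwoPoint S) (htr : IsTranslationInvariant S) (hsc : IsScaleCovariant Δ S)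
    {v : ℝ} (hv : 1 < v) :
    ¬ ∃ μ : Measure (EuclideanSpace ℝ (Fin 2) × ℝ),
      μ {p : EuclideanSpace ℝ (Fin 2) × ℝ | p.2 < v * ‖p.1‖} = 0 ∧
        ∀ t a b : ℝ, t ≠ 0 → (fun x : EuclideanSpace ℝ (Fin 3) => S 2 ![0, x])
          (EuclideanSpace.single 0 a + EuclideanSpace.single 1 b + EuclideanSpace.single 2 t) =
            ∫ p, Real.cos (p.1 0 * a + p.1 1 * b) * Real.exp (-(p.2 * |t|)) ∂μ := by
  sorry

end NearMisses

end Summit.CriticalPhenomena.Ising3DConformalLimit.Cruxes.UnitSpeedTwoPoint.Disproof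

end
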